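import Literature.NumberTheory.Transcendental.KZSemialgebraicComplex
import HarnessLib

/-!
# Scaling by a real algebraic constant is `ℚ`-semialgebraic — explicitly

Kontsevich–Zagier allow real *algebraic* coefficients in the (in)equalities and integrands of a
period integral, because a real algebraic number is `ℚ`-definable [Kontsevich–Zagier 2001, §1.1].
The tree has the constant case (`isSemialgebraicFunOn_const_of_isAlgebraic`: `x ↦ c` is a
`ℚ`-semialgebraic function) and obtains products such as `x ↦ c · x j` from the closure of
semialgebraic functions under multiplication (`IsSemialgebraicFunOn.mul_holds`), i.e. through the
Tarski–Seidenberg projection theorem. This file gives the **explicit, projection-free** description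
of the graph of multiplication by a real algebraic scalar `s`:

* `exists_rat_isolating_of_isAlgebraic` — `s` is isolated among the real roots of one of its
  nonzero annihilating polynomials `f ∈ ℚ[X]` by a rational interval `(p, q)`;
* `exists_mvPolynomial_homog` — the two-coordinate homogenisation `F = Σₖ fₖ Xⱼᵏ Xᵢ^{d−k}` of `f`,
  `F(z) = zᵢ^d f(zⱼ/zᵢ)`;
* `isSemialgebraic_setOf_pos_and_apply_eq_mul_apply` — for `zᵢ > 0`,
  `zⱼ = s zᵢ ⇔ F(z) = 0 ∧ p zᵢ < zⱼ < q zᵢ`, so the sector graph is cut out by four `ℚ`-polynomial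
  (in)equalities;
* `isSemialgebraic_setOf_apply_eq_mul_apply_of_isAlgebraic` — the full hyperplane `{zⱼ = s zᵢ}`
  (sector ∪ its mirror image under the polynomial map `z ↦ −z` ∪ `{zᵢ = zⱼ = 0}`);
* `isSemialgebraic_setOf_aeval_eq_mul_aeval_of_isAlgebraic` — `{P(z) = s · Q(z)}` for
  `ℚ`-polynomials `P`, `Q` (a polynomial preimage of the hyperplane);
* `isSemialgebraicFunOn_const_mul_aeval_of_isAlgebraic`, `isSemialgebraicFunOn_const_mul_apply_of_isAlgebraic`
  — `x ↦ s · P(x)` and `x ↦ s · x j` are `ℚ`-semialgebraic functions on every `ℚ`-semialgebraic set;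
* `isSemialgebraicMapOn_smul_of_isAlgebraic` — the dilation `x ↦ s • x` of `ℝⁿ` is a
  `ℚ`-semialgebraic map on every `ℚ`-semialgebraic set (the chart of Kontsevich–Zagier's rule (2)
  for scalings by algebraic factors).

## References

* J. Bochnak, M. Coste, M.-F. Roy, *Real Algebraic Geometry*, Springer (1998), §2.1 (semialgebraic
  sets; real algebraic numbers are described by a polynomial and an isolating interval).
* M. Kontsevich, D. Zagier, *Periods* (2001), §1.1 ("rational" may be replaced by "algebraic").

## Design notes

* Everything is over `k = ℚ`, `R = ℝ`, coordinates `Fin n`, matching `KZ.IntegralRep`.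
* No use of `tarski_seidenberg_real`: only the Boolean closure of basic semialgebraic sets,
  polynomial preimages (`IsSemialgebraic.preimage_aeval`) and finiteness of the real roots of a
  nonzero rational polynomial.
* NOT here: products `s · f` for a general semialgebraic `f` (that is `IsSemialgebraicFunOn.mul`,
  which needs projection), and translations by algebraic vectors.
-/

noncomputable section

open Set MvPolynomial
open Literature.ModelTheory.ExponentialFields

namespace Literature.NumberTheory.Transcendental

variable {n : ℕ}

/-! ### Isolating a real algebraic number by rationals -/

/-- A real algebraic number `s` is isolated among the real roots of one of its nonzero
annihilating polynomials `f ∈ ℚ[X]` by a rational interval `(p, q) ∋ s`: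
`f(t) = 0 ∧ p < t < q ⇔ t = s`. [cite: BochnakCosteRoy1998, §2.1] -/
theorem exists_rat_isolating_of_isAlgebraic {s : ℝ} (hs : IsAlgebraic ℚ s) :
    ∃ (f : Polynomial ℚ) (p q : ℚ), (p : ℝ) < s ∧ s < q ∧
      ∀ t : ℝ, (Polynomial.aeval t f = 0 ∧ (p : ℝ) < t ∧ t < q) ↔ t = s := by
  obtain ⟨f, hf0, hfs⟩ := hs
  have hfin : (f.rootSet ℝ).Finite := Polynomial.rootSet_finite f ℝ
  -- a punctured neighbourhood of `s` free of roots of `f`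
  obtain ⟨δ, hδ, hfar⟩ : ∃ δ > 0, ∀ t ∈ f.rootSet ℝ, t ≠ s → δ ≤ dist t s := by
    have hopen : IsOpen (f.rootSet ℝ \ {s})ᶜ :=
      (hfin.subset fun x hx => hx.1).isClosed.isOpen_compl
    obtain ⟨δ, hδ, hsub⟩ := Metric.isOpen_iff.mp hopen s (fun h => h.2 rfl)
    refine ⟨δ, hδ, fun t ht hts => ?_⟩
    by_contra h
    exact hsub (Metric.mem_ball.mpr (not_le.mp h)) ⟨ht, hts⟩
  obtain ⟨p, hsp, hps⟩ := exists_rat_btwn (sub_lt_self s hδ)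
  obtain ⟨q, hsq, hqs⟩ := exists_rat_btwn (lt_add_of_pos_right s hδ)
  refine ⟨f, p, q, hps, hsq, fun t => ⟨?_, ?_⟩⟩
  · rintro ⟨ht, h1, h2⟩
    by_contra hne
    have hroot : t ∈ f.rootSet ℝ := Polynomial.mem_rootSet.mpr ⟨hf0, ht⟩
    have hd := hfar t hroot hne
    rw [Real.dist_eq] at hd
    have habs : |t - s| < δ := abs_sub_lt_iff.mpr ⟨by linarith, by linarith⟩
    exact (not_le.mpr habs) hd
  · rintro rfl
    exact ⟨hfs, hps, hsq⟩

/-! ### Homogenisation in two coordinates -/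

/-- **Homogenisation.** For `f ∈ ℚ[X]` of degree `d` and coordinates `i`, `j` there is a
`ℚ`-polynomial `F` in `n` variables (namely `F = Σₖ fₖ Xⱼᵏ Xᵢ^{d−k}`, so that
`F(z) = (z i)^d · f (z j / z i)`) with `F(z) = 0 ⇔ f (z j / z i) = 0` off the hyperplane
`z i = 0`. [cite: BochnakCosteRoy1998, §2.1] -/
theorem exists_mvPolynomial_homog (f : Polynomial ℚ) (i j : Fin n) :
    ∃ F : MvPolynomial (Fin n) ℚ, ∀ z : Fin n → ℝ, z i ≠ 0 →
      (aeval z F = 0 ↔ Polynomial.aeval (z j / z i) f = 0) := by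
  refine ⟨∑ k ∈ Finset.range (f.natDegree + 1),
    C (f.coeff k) * X j ^ k * X i ^ (f.natDegree - k), fun z hz => ?_⟩
  have key : aeval z (∑ k ∈ Finset.range (f.natDegree + 1),
      C (f.coeff k) * X j ^ k * X i ^ (f.natDegree - k) : MvPolynomial (Fin n) ℚ) =
      z i ^ f.natDegree * Polynomial.aeval (z j / z i) f := by
    rw [Polynomial.aeval_eq_sum_range, Finset.mul_sum, map_sum]
    refine Finset.sum_congr rfl fun k hk => ?_
    have hk' : k ≤ f.natDegree := Nat.lt_succ_iff.mp (Finset.mem_range.mp hk)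
    have hu : z i ^ f.natDegree = z i ^ k * z i ^ (f.natDegree - k) := by
      rw [← pow_add, Nat.add_sub_cancel' hk']
    simp only [map_mul, map_pow, aeval_C, aeval_X, eq_ratCast, Algebra.smul_def, hu, div_pow]
    field_simp
  rw [key, mul_eq_zero, or_iff_right (pow_ne_zero _ hz)]

/-! ### The graph of multiplication by a real algebraic scalar -/

/-- **The sector graph.** For a real algebraic `s` and coordinates `i`, `j`, the set
`{z | 0 < z i ∧ z j = s · z i}` is `ℚ`-semialgebraic, EXPLICITLY: with `f`, `p`, `q` isolating `s`
(`exists_rat_isolating_of_isAlgebraic`) and `F` the homogenisation of `f` it equals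
`{0 < zᵢ} ∩ {F = 0} ∩ {p zᵢ < zⱼ} ∩ {zⱼ < q zᵢ}` (for `zᵢ > 0`: `zⱼ = s zᵢ ⇔ zⱼ/zᵢ = s
⇔ f(zⱼ/zᵢ) = 0 ∧ p < zⱼ/zᵢ < q`). No projection theorem is used.
[cite: BochnakCosteRoy1998, §2.1] -/
theorem isSemialgebraic_setOf_pos_and_apply_eq_mul_apply {s : ℝ} (hs : IsAlgebraic ℚ s)
    (i j : Fin n) : IsSemialgebraic ℚ {z : Fin n → ℝ | 0 < z i ∧ z j = s * z i} := by
  obtain ⟨f, p, q, hps, hsq, hiso⟩ := exists_rat_isolating_of_isAlgebraic hs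
  obtain ⟨F, hF⟩ := exists_mvPolynomial_homog f i j
  have hfs : Polynomial.aeval s f = 0 := ((hiso s).mpr rfl).1
  have hset : {z : Fin n → ℝ | 0 < z i ∧ z j = s * z i} =
      {z | 0 < aeval z (X i : MvPolynomial (Fin n) ℚ)} ∩ ({z | aeval z F = 0} ∩
        ({z | aeval z (C p * X i : MvPolynomial (Fin n) ℚ) <
            aeval z (X j : MvPolynomial (Fin n) ℚ)} ∩
          {z | aeval z (X j : MvPolynomial (Fin n) ℚ) <
            aeval z (C q * X i : MvPolynomial (Fin n) ℚ)})) := by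
    ext z
    simp only [mem_setOf_eq, mem_inter_iff, map_mul, aeval_X, aeval_C, eq_ratCast]
    constructor
    · rintro ⟨hzi, hzj⟩
      refine ⟨hzi, ?_, ?_, ?_⟩
      · rw [hF z hzi.ne', hzj, mul_div_cancel_right₀ _ hzi.ne']
        exact hfs
      · rw [hzj]; exact mul_lt_mul_of_pos_right hps hzi
      · rw [hzj]; exact mul_lt_mul_of_pos_right hsq hzi
    · rintro ⟨hzi, hF0, h1, h2⟩
      have ht : z j / z i = s :=
        (hiso _).mp ⟨(hF z hzi.ne').mp hF0, by rwa [lt_div_iff₀ hzi], by rwa [div_lt_iff₀ hzi]⟩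
      exact ⟨hzi, by rw [← ht, div_mul_cancel₀ _ hzi.ne']⟩
  rw [hset]
  exact (isSemialgebraic_setOf_eval_pos _).inter ((isSemialgebraic_setOf_eval_eq_zero _).inter
    ((isSemialgebraic_setOf_eval_lt _ _).inter (isSemialgebraic_setOf_eval_lt _ _)))

/-- **The hyperplane `{zⱼ = s zᵢ}`.** For a real algebraic `s` and coordinates `i`, `j`, the set
`{z | z j = s · z i}` is `ℚ`-semialgebraic, EXPLICITLY: it is the union of the sector graph over
`{0 < zᵢ}` (`isSemialgebraic_setOf_pos_and_apply_eq_mul_apply`), its mirror image under the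
`ℚ`-polynomial map `z ↦ −z` (a preimage; the part over `{zᵢ < 0}`), and the coordinate plane
`{zᵢ = 0, zⱼ = 0}`. No projection theorem is used. [cite: BochnakCosteRoy1998, §2.1] -/
theorem isSemialgebraic_setOf_apply_eq_mul_apply_of_isAlgebraic {s : ℝ} (hs : IsAlgebraic ℚ s)
    (i j : Fin n) : IsSemialgebraic ℚ {z : Fin n → ℝ | z j = s * z i} := by
  have hA := isSemialgebraic_setOf_pos_and_apply_eq_mul_apply hs i j
  have hB : IsSemialgebraic ℚ ({z : Fin n → ℝ | aeval z (X i : MvPolynomial (Fin n) ℚ) = 0} ∩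
      {z | aeval z (X j : MvPolynomial (Fin n) ℚ) = 0}) :=
    (isSemialgebraic_setOf_eval_eq_zero _).inter (isSemialgebraic_setOf_eval_eq_zero _)
  have hC := hA.preimage_aeval (fun k : Fin n => (-X k : MvPolynomial (Fin n) ℚ))
  convert hA.union (hB.union hC) using 1
  ext z
  simp only [mem_setOf_eq, mem_union, mem_inter_iff, mem_preimage, map_neg, aeval_X, neg_pos,
    mul_neg, neg_inj]
  constructor
  · intro hz
    rcases lt_trichotomy 0 (z i) with h | h | h
    · exact Or.inl ⟨h, hz⟩
    · exact Or.inr (Or.inl ⟨h.symm, by rw [hz, ← h, mul_zero]⟩)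
    · exact Or.inr (Or.inr ⟨h, hz⟩)
  · rintro (⟨-, hz⟩ | ⟨hzi, hzj⟩ | ⟨-, hz⟩)
    · exact hz
    · rw [hzi, hzj, mul_zero]
    · exact hz

/-- **`{P = s · Q}` for `ℚ`-polynomials `P`, `Q` and a real algebraic `s`** is `ℚ`-semialgebraic:
it is the preimage of the hyperplane `{w₁ = s w₀} ⊆ ℝ²`
(`isSemialgebraic_setOf_apply_eq_mul_apply_of_isAlgebraic`) under the polynomial map
`z ↦ (Q(z), P(z))`. No projection theorem is used. [cite: BochnakCosteRoy1998, §2.1] -/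
theorem isSemialgebraic_setOf_aeval_eq_mul_aeval_of_isAlgebraic {s : ℝ} (hs : IsAlgebraic ℚ s)
    (P Q : MvPolynomial (Fin n) ℚ) :
    IsSemialgebraic ℚ {z : Fin n → ℝ | aeval z P = s * aeval z Q} := by
  have hT := isSemialgebraic_setOf_apply_eq_mul_apply_of_isAlgebraic (n := 2) hs 0 1
  convert hT.preimage_aeval (![Q, P] : Fin 2 → MvPolynomial (Fin n) ℚ) using 1
  ext z
  simp

/-- **Multiplication of a `ℚ`-polynomial by a real algebraic constant** `x ↦ s · P(x)` is a
`ℚ`-semialgebraic function on every `ℚ`-semialgebraic set `σ`: its graph is the cylinder over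
`σ` cut by `{z_last = s · P(init z)}` (`isSemialgebraic_setOf_aeval_eq_mul_aeval_of_isAlgebraic`).
[cite: BochnakCosteRoy1998, §2.1] -/
theorem isSemialgebraicFunOn_const_mul_aeval_of_isAlgebraic {σ : Set (Fin n → ℝ)}
    (hσ : IsSemialgebraic ℚ σ) {s : ℝ} (hs : IsAlgebraic ℚ s) (P : MvPolynomial (Fin n) ℚ) :
    IsSemialgebraicFunOn ℚ σ (fun x => s * aeval x P) := by
  rw [isSemialgebraicFunOn_iff]
  convert hσ.setOf_init_mem.inter (isSemialgebraic_setOf_aeval_eq_mul_aeval_of_isAlgebraic hs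
    (X (Fin.last n)) (rename Fin.castSucc P)) using 1
  ext z
  have hinit : (fun i => z (Fin.castSucc i)) = Fin.init z := rfl
  simp only [mem_setOf_eq, mem_inter_iff, aeval_X, aeval_rename, Function.comp_def, hinit]

/-- **Multiplication of a coordinate by a real algebraic constant** `x ↦ s · x j` is a
`ℚ`-semialgebraic function on every `ℚ`-semialgebraic set (the case `P = Xⱼ` of
`isSemialgebraicFunOn_const_mul_aeval_of_isAlgebraic`). [cite: BochnakCosteRoy1998, §2.1] -/
theorem isSemialgebraicFunOn_const_mul_apply_of_isAlgebraic {σ : Set (Fin n → ℝ)}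
    (hσ : IsSemialgebraic ℚ σ) {s : ℝ} (hs : IsAlgebraic ℚ s) (j : Fin n) :
    IsSemialgebraicFunOn ℚ σ (fun x => s * x j) := by
  simpa using isSemialgebraicFunOn_const_mul_aeval_of_isAlgebraic hσ hs (X j)

/-- **The dilation `x ↦ s • x` of `ℝⁿ` by a real algebraic factor `s` is a `ℚ`-semialgebraic map**
on every `ℚ`-semialgebraic set (coordinatewise
`isSemialgebraicFunOn_const_mul_apply_of_isAlgebraic`; explicit, no projection theorem). This is
the chart of Kontsevich–Zagier's rule (2) for scalings by algebraic factors.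
[cite: KontsevichZagier2001, §1.1] -/
theorem isSemialgebraicMapOn_smul_of_isAlgebraic {σ : Set (Fin n → ℝ)} (hσ : IsSemialgebraic ℚ σ)
    {s : ℝ} (hs : IsAlgebraic ℚ s) :
    IsSemialgebraicMapOn ℚ σ (fun x : Fin n → ℝ => s • x) :=
  IsSemialgebraicMapOn.of_forall hσ fun j =>
    (isSemialgebraicFunOn_const_mul_apply_of_isAlgebraic hσ hs j).congr fun x _ => by
      simp only [Pi.smul_apply, smul_eq_mul]

end Literature.NumberTheory.Transcendental
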